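import Mathlib
import Literature.MathematicalPhysics.QuantumFieldTheory.Balaban1983to89.B8Eq194CriterionCarriersWitness

/-!
# G-B8-19 (c) at EVERY background: the criterion Q′ΔN(Q′) = 0 fails on the (3.25)-lattice carriers as soon as two
# blocks are joined by a bond and one of them has a site away from the other — for ALL transports U; on the free box
# with blocks of side L ≥ 2 (K ≥ 2 per axis) and on the torus ((L, K) ≠ (2, 2)) (1.91)'s H′ ≠ [4]'s H′ (3.163) for
# every background, and L = 1 ⟹ equal

statement-level skeleton of published theorems with citation tags; proofs where landed; nothing here is a claim
about the Yang–Mills mass gap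

Seat p40 gen 9, Phase 2 (free target D; owner r05 row B8.Eq1.91; GAPS G-B8-19 (c), addendum 5's remaining OPEN item
«backgrounds with curvature»).  Sources: [Balaban1985RegularSpaces] T. Bałaban, *Spaces of regular gauge field
configurations on a lattice and gauge fixing conditions*, CMP 99 (1985) 75–102: (1.91) p. 91 [PDF 17] «H′ =
G′²Q′\*(Q′G′²Q′\*)⁻¹, G′ = (Δ + Q′\*aQ′)⁻¹»; [Balaban1985BackgroundPropagators] T. Bałaban, *Propagators for lattice
gauge theories in a background field*, CMP 99 (1985) 389–434: (3.19) p. 393 «(Q′_j(U)λ)(y) = Σ_{x∈B^j(y)} …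
R(U(Γ^{(j)}_{y,x}))λ(x)», (3.23) p. 394 «Δ^η_U = D^{η\*}_U D^η_U», (3.21)–(3.25) p. 394, (3.162)–(3.165) p. 429 (OCR pages
p0005, p0006, p0041 of `paper:balaban1985-cmp99-background-propagators`); [Balaban1985Averaging] (2) p. 17 (the cubes
B(y)).

v1.2 (p40 gen 11, docstring-only): the five locators «(3.3) p. 390» → «(3.3) p. 391» (CMP 99 p. 391 opens with the display (3.3);
citeloc P35-003 of b2b-balaban-summit-lit1; declarations untouched).

WHY THIS FILE.  Gen 7–8 and parts 6/6b/7 of this seat decided «[4]'s H′ of (3.163) = (1.91)'s H′ ⟺ Q′ΔN(Q′) = 0»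
(`B8Eq194FirstTerm.H4_eq_Hp_of_criterion` / `criterion_of_H4_eq_Hp`) at FLAT and PURE-GAUGE backgrounds (where the
criterion reduces to the scalar `Crit`): on the free box ⟺ L = 1 ∨ K = 1.  GAPS G-B8-19 (c) ADDENDUM 5 left open the
backgrounds WITH curvature, where the transports enter Q′ and Δ genuinely.  This file settles the K ≥ 2 case for ALL
backgrounds at once, by a two-site test function that does not see the curvature:
λ := δ_{x₁}v₁ + δ_{x₂}v₂ with x₁, x₂ in one block c′ (and in no other), v₂ chosen so that the c′-average vanishes
(R(U(Γ_{y,x₂})) is onto), x₂ with no bond to a second block c, and x₁ joined to c by a bond ⟨x₀, x₁⟩ with x₀ the only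
neighbour of x₁ in B(c).  Then λ ∈ N(Q′), (Δλ)(x) = 0 on B(c) ∖ {x₀} and (Δλ)(x₀) = −c_{⟨x₀x₁⟩}R(U(⟨x₀,x₁⟩))v₁ (resp.
−c R(U)\*v₁ for the other orientation) ≠ 0 — read off from ⟨Δλ, δ_{x₀}v⟩ = ⟨Dλ, Dδ_{x₀}v⟩ ((3.23)) without a pointwise
formula for Δ — so (Q′Δλ)(c) = w(c,x₀)R(U(Γ_{y(c),x₀}))(Δλ)(x₀) ≠ 0.  No block-system axiom beyond «x₁, x₂ lie in c′
only» is used: contours and centres are arbitrary.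

CONTENT.
§1 `single x v` = δ_x v on E = PiLp 2 (X → V); `qL_single` ((Q′δ_z v)(c) = [z ∈ B(c)] w(c,z)R(U(Γ_{y(c),z}))v),
   `inner_single_right`, **`inner_lapL_apply`** (⟨(Δf)(x), v⟩ = Σ_b c_b⟨(D_U f)(b), (D_U δ_x v)(b)⟩), `lapL_apply_eq_zero`
   ((Δf)(x) = 0 if f vanishes at x and at its neighbours), `inner_lapL_apply_near` (the value at a site with exactly one
   charged neighbour), `eq_zero_of_near` (that value determines the charge).
§2 **`not_criterion_of_adjacent_blocks`** (the abstract theorem above: ¬ ∀λ, Q′λ = 0 → Q′Δλ = 0), and its H′ form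
   **`exists_Hp_ne_H4_of_adjacent_blocks`** (any (3.25)-data with a onto).  Converse side: `eq_zero_of_qL_eq_zero_of_subsingleton`
   / **`criterion_of_subsingleton_blocks`** (one-site blocks: N(Q′) = 0, the criterion holds at every background),
   `H4_eq_Hp_of_subsingleton_blocks`.
§3 THE FREE BOX of parts 6/6b (sites Fin d → Fin (L·K), bonds ⟨x, x + e_i⟩ `boxBonds`, cubic blocks `boxBlk`), EVERY
   background: **`not_criterion_box`** (L = l + 1 ≥ 2, K ≥ 2, d ≥ 1; any τ injective, c_b > 0, block weights ≠ 0, any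
   contours/centres), **`Hp_ne_H4_box_background`** (any (3.25)-data with a = diag(a_c), a_c ≠ 0), hypothesis-free
   **`exists_data_Hp_ne_H4_box_background`** (the data of record `gL`/`cL` exist at every background on the printed cubes —
   `B9Thm311Lattice.obvious_311_lattice` via `B8Eq191Hprime.data_L` — and the two H′ differ); and **`H4_eq_Hp_box_L1`**
   (L = 1: equal for every background and every data).  With parts 6/7: on the free box with K ≥ 2 blocks per axis,
   «(1.91)'s H′ = [4]'s H′» holds at EVERY background iff L = 1, and fails at EVERY background iff L ≥ 2.
§4 THE TORUS (ℤ/(LK))^d of parts 2/6 (`torusBonds`), EVERY background: **`not_criterion_torus`** (L ≥ 2, K ≥ 2,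
   (L, K) ≠ (2, 2) — stated as K ≥ 3 ∨ L ≥ 3 — d ≥ 1; the far site is the cube corner if K ≥ 3, the site e_{i₀} if
   L ≥ 3), **`Hp_ne_H4_torus_background`**, `exists_data_Hp_ne_H4_torus_background`.
§5 ONE BLOCK (K = 1) IS BACKGROUND-DEPENDENT: `defectT p q R` (transports 1 except R on the bond ⟨p, q⟩),
   `pathTr_defectT_of_avoid`, **`not_criterion_oneBlock_defect`** (one block with uniform weight, contours avoiding
   ⟨p, q⟩, R invertible ≠ 1, a third site: λ = δ_q u − δ_r u ∈ N(Q′) has ⟨(Q′Δλ)(c), v⟩ = κc_{⟨p,q⟩}⟨Ru, Rv − v⟩ ≠ 0 —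
   the criterion FAILS, while at R = 1 (flat, one block) it holds by part 6).

HONEST SCOPE.  (i) K = 1 (Ω₀ = one block) is background-DEPENDENT: the flat criterion holds (part 6) while §5's
one-defect background violates it; no classification of the K = 1 backgrounds is attempted.  (ii) On the torus the
case (L, K) = (2, 2) is not covered (every site of a cube is bonded to the neighbouring cube, so the abstract theorem
does not apply; the flat criterion HOLDS there, part 2) — no claim; [4]'s Dirichlet b.c. (part 3, abstract weights) is
not instantiated; the abstract theorem is stated for an arbitrary bond set with the displayed adjacency pattern.
(iii) Bonds in both orientations are allowed under the compatibility R(U(⟨x₁,x₀⟩)) = R(U(⟨x₀,x₁⟩))\* (vacuous on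
`boxBonds`, which carry one orientation).  (iv) Fibre V = any finite-dimensional real inner-product space ≠ 0,
transports any injective linear maps (R(U(b)) ∈ O(𝔤) in print).  No bound, no row head
changes; value = the background-independence of the H′-discrepancy recorded in G-B8-19, NOT summit progress.
-/

namespace Literature.MathematicalPhysics.QuantumFieldTheory.Balaban1983to89.B8Eq194CriterionCurved

open Finset
open Literature.MathematicalPhysics.QuantumFieldTheory.Balaban1983to89.B9Eq323Ker
  Literature.MathematicalPhysics.QuantumFieldTheory.Balaban1983to89.B9Thm311Lattice
  Literature.MathematicalPhysics.QuantumFieldTheory.Balaban1983to89.B9Eq325Proj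
  Literature.MathematicalPhysics.QuantumFieldTheory.Balaban1983to89.B8Eq191Hprime
  Literature.MathematicalPhysics.QuantumFieldTheory.Balaban1983to89.B8Eq194FirstTerm
  Literature.MathematicalPhysics.QuantumFieldTheory.Balaban1983to89.B8Eq194CriterionLattice
  Literature.MathematicalPhysics.QuantumFieldTheory.Balaban1983to89.B8Eq194CriterionCarriers
  Literature.MathematicalPhysics.QuantumFieldTheory.Balaban1983to89.B8Eq194CriterionCarriersWitness
open scoped InnerProductSpace

/-! ## §1  One-site functions and the two pairing formulas -/

section Single

variable {X : Type*} {Y : Type*} {V : Type*} [NormedAddCommGroup V] [InnerProductSpace ℝ V] [DecidableEq X]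

/-- δ_x v : the 𝔤-valued function equal to v at x and 0 elsewhere. [cite: Balaban1985BackgroundPropagators, (3.19) p. 393] -/
def single (x : X) (v : V) : PiLp 2 (fun _ : X => V) := WithLp.toLp 2 (Pi.single x v)

omit [InnerProductSpace ℝ V] in
/-- Pointwise values of `single`. [cite: Balaban1985BackgroundPropagators, (3.19) p. 393] -/
theorem single_apply (x : X) (v : V) (x' : X) : single x v x' = if x' = x then v else 0 :=
  Pi.single_apply x v x'

omit [InnerProductSpace ℝ V] in
/-- The underlying function of `single`. [cite: Balaban1985BackgroundPropagators, (3.19) p. 393] -/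
theorem ofLp_single (x : X) (v : V) : WithLp.ofLp (single x v) = Pi.single x v := rfl

/-- **(Q′δ_z v)(c) = [z ∈ B(c)]·w(c,z)·R(U(Γ_{y(c),z}))v** ((3.19) on a one-site function).
[cite: Balaban1985BackgroundPropagators, (3.19) p. 393] -/
theorem qL_single (τ : X → X → V →ₗ[ℝ] V) (w : Y → X → ℝ) (B : Y → Finset X) (Γ : Y → X → List X)
    (y : Y → X) (z : X) (v : V) (c : Y) :
    qL τ w B Γ y (single z v) c = if z ∈ B c then w c z • pathTr τ (y c :: Γ c z) v else 0 := by
  rw [qL_apply, ofLp_single]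
  unfold avgQ
  split_ifs with hz
  · rw [← Finset.add_sum_erase (B c) _ hz, Pi.single_eq_same, Finset.sum_eq_zero, add_zero]
    intro x hx
    rw [Pi.single_eq_of_ne (Finset.ne_of_mem_erase hx), map_zero, smul_zero]
  · refine Finset.sum_eq_zero fun x hx => ?_
    rw [Pi.single_eq_of_ne (ne_of_mem_of_not_mem hx hz), map_zero, smul_zero]

variable [Fintype X]

/-- ⟨f, δ_x v⟩ = ⟨f(x), v⟩. [cite: Balaban1985BackgroundPropagators, (3.23) p. 394] -/
theorem inner_single_right (f : PiLp 2 (fun _ : X => V)) (x : X) (v : V) : ⟪f, single x v⟫_ℝ = ⟪f x, v⟫_ℝ := by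
  rw [PiLp.inner_apply, ← Finset.add_sum_erase univ _ (mem_univ x), single_apply, if_pos rfl,
    Finset.sum_eq_zero, add_zero]
  intro x' hx'
  rw [single_apply, if_neg (Finset.ne_of_mem_erase hx'), inner_zero_right]

variable [FiniteDimensional ℝ V]

/-- **⟨(Δf)(x), v⟩ = Σ_b c_b ⟨(D_U f)(b), (D_U δ_x v)(b)⟩** — the value of Δ = D†D ((3.23)) at a site, read through the
quadratic form (no pointwise formula for Δ needed). [cite: Balaban1985BackgroundPropagators, (3.23) p. 394] -/
theorem inner_lapL_apply (τ : X → X → V →ₗ[ℝ] V) (bonds : Finset (X × X)) (cb : X × X → ℝ)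
    (hcb : ∀ b ∈ bonds, 0 ≤ cb b) (f : PiLp 2 (fun _ : X => V)) (x : X) (v : V) :
    ⟪lapL τ bonds cb f x, v⟫_ℝ
      = ∑ b ∈ bonds, cb b * ⟪covD τ (WithLp.ofLp f) b.1 b.2, covD τ (Pi.single x v) b.1 b.2⟫_ℝ := by
  rw [← inner_single_right, inner_lapL_left, PiLp.inner_apply,
    ← Finset.sum_coe_sort bonds
      (fun b => cb b * ⟪covD τ (WithLp.ofLp f) b.1 b.2, covD τ (Pi.single x v) b.1 b.2⟫_ℝ)]
  refine Finset.sum_congr rfl fun b _ => ?_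
  rw [DL_apply, DL_apply, ofLp_single, real_inner_smul_left, real_inner_smul_right, ← mul_assoc,
    Real.mul_self_sqrt (hcb b.1 b.2)]

/-- (Δf)(x) = 0 when f vanishes at x and at every site bonded to x. [cite: Balaban1985BackgroundPropagators, (3.23) p. 394] -/
theorem lapL_apply_eq_zero (τ : X → X → V →ₗ[ℝ] V) (bonds : Finset (X × X)) (cb : X × X → ℝ)
    (hcb : ∀ b ∈ bonds, 0 ≤ cb b) (f : PiLp 2 (fun _ : X => V)) (x : X) (hx : f x = 0)
    (hnb : ∀ z, ((x, z) ∈ bonds ∨ (z, x) ∈ bonds) → f z = 0) : lapL τ bonds cb f x = 0 := by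
  have h : ∀ v, ⟪lapL τ bonds cb f x, v⟫_ℝ = 0 := by
    intro v
    rw [inner_lapL_apply τ bonds cb hcb f x v]
    refine Finset.sum_eq_zero fun b hb => ?_
    obtain ⟨p, q⟩ := b
    dsimp only
    by_cases hp : p = x
    · subst hp
      have e : covD τ (WithLp.ofLp f) p q = 0 := by
        rw [covD_apply]
        show τ p q (f q) - f p = 0
        rw [hnb q (Or.inl hb), hx, map_zero, sub_zero]
      rw [e, inner_zero_left, mul_zero]
    · by_cases hq : q = x
      · subst hq
        have e : covD τ (WithLp.ofLp f) p q = 0 := by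
          rw [covD_apply]
          show τ p q (f q) - f p = 0
          rw [hx, hnb p (Or.inr hb), map_zero, sub_zero]
        rw [e, inner_zero_left, mul_zero]
      · have e : covD τ (Pi.single x v) p q = 0 := by
          rw [covD_apply, Pi.single_eq_of_ne hq, Pi.single_eq_of_ne hp, map_zero, sub_zero]
        rw [e, inner_zero_right, mul_zero]
  exact inner_self_eq_zero.mp (h _)

/-- two-point extraction from a finite sum. [folklore] -/
private theorem sum_eq_two {α : Type*} [DecidableEq α] (s : Finset α) (F : α → ℝ) (a b : α) (hab : a ≠ b)
    (h0 : ∀ z ∈ s, z ≠ a → z ≠ b → F z = 0) :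
    ∑ z ∈ s, F z = (if a ∈ s then F a else 0) + (if b ∈ s then F b else 0) := by
  have e : ∀ z ∈ s, F z = (if z = a then F a else 0) + (if z = b then F b else 0) := by
    intro z hz
    by_cases hza : z = a
    · subst hza
      rw [if_pos rfl, if_neg hab, add_zero]
    · by_cases hzb : z = b
      · subst hzb
        rw [if_neg hza, if_pos rfl, zero_add]
      · rw [if_neg hza, if_neg hzb, add_zero]
        exact h0 z hz hza hzb
  rw [Finset.sum_congr rfl e, Finset.sum_add_distrib, Finset.sum_ite_eq' s a (fun _ => F a),
    Finset.sum_ite_eq' s b (fun _ => F b)]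

/-- **The value of Δf at a site x₀ with exactly one charged neighbour x₁** (f(x₀) = 0, f = 0 at every other
neighbour): ⟨(Δf)(x₀), v⟩ = −(c_{⟨x₀,x₁⟩}⟨R(U(⟨x₀,x₁⟩))f(x₁), v⟩ + c_{⟨x₁,x₀⟩}⟨f(x₁), R(U(⟨x₁,x₀⟩))v⟩), each term present
iff that orientation is a bond. [cite: Balaban1985BackgroundPropagators, (3.23) p. 394, (3.3) p. 391] -/
theorem inner_lapL_apply_near (τ : X → X → V →ₗ[ℝ] V) (bonds : Finset (X × X)) (cb : X × X → ℝ)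
    (hcb : ∀ b ∈ bonds, 0 ≤ cb b) (f : PiLp 2 (fun _ : X => V)) {x₀ x₁ : X} (h10 : x₁ ≠ x₀)
    (hx₀ : f x₀ = 0) (hnb : ∀ z, z ≠ x₁ → ((x₀, z) ∈ bonds ∨ (z, x₀) ∈ bonds) → f z = 0) (v : V) :
    ⟪lapL τ bonds cb f x₀, v⟫_ℝ
      = -((if (x₀, x₁) ∈ bonds then cb (x₀, x₁) * ⟪τ x₀ x₁ (f x₁), v⟫_ℝ else 0)
          + (if (x₁, x₀) ∈ bonds then cb (x₁, x₀) * ⟪f x₁, τ x₁ x₀ v⟫_ℝ else 0)) := by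
  rw [inner_lapL_apply τ bonds cb hcb f x₀ v,
    sum_eq_two bonds _ (x₀, x₁) (x₁, x₀) (fun h => h10 (Prod.mk.inj h).1.symm) ?_]
  · have e1 : covD τ (WithLp.ofLp f) x₀ x₁ = τ x₀ x₁ (f x₁) := by
      rw [covD_apply]
      show τ x₀ x₁ (f x₁) - f x₀ = _
      rw [hx₀, sub_zero]
    have e2 : covD τ (Pi.single x₀ v) x₀ x₁ = -v := by
      rw [covD_apply, Pi.single_eq_of_ne h10, map_zero, Pi.single_eq_same, zero_sub]
    have e3 : covD τ (WithLp.ofLp f) x₁ x₀ = -(f x₁) := by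
      rw [covD_apply]
      show τ x₁ x₀ (f x₀) - f x₁ = _
      rw [hx₀, map_zero, zero_sub]
    have e4 : covD τ (Pi.single x₀ v) x₁ x₀ = τ x₁ x₀ v := by
      rw [covD_apply, Pi.single_eq_same, Pi.single_eq_of_ne h10, sub_zero]
    simp only [e1, e2, e3, e4, inner_neg_right, inner_neg_left, mul_neg]
    split_ifs <;> ring
  · rintro ⟨p, q⟩ hb hb1 hb2
    dsimp only
    by_cases hp : p = x₀
    · subst hp
      have hq : q ≠ x₁ := fun h => hb1 (by rw [h])
      have e : covD τ (WithLp.ofLp f) p q = 0 := by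
        rw [covD_apply]
        show τ p q (f q) - f p = 0
        rw [hnb q hq (Or.inl hb), hx₀, map_zero, sub_zero]
      rw [e, inner_zero_left, mul_zero]
    · by_cases hq : q = x₀
      · subst hq
        have hp1 : p ≠ x₁ := fun h => hb2 (by rw [h])
        have e : covD τ (WithLp.ofLp f) p q = 0 := by
          rw [covD_apply]
          show τ p q (f q) - f p = 0
          rw [hx₀, hnb p hp1 (Or.inr hb), map_zero, sub_zero]
        rw [e, inner_zero_left, mul_zero]
      · have e : covD τ (Pi.single x₀ v) p q = 0 := by
          rw [covD_apply, Pi.single_eq_of_ne hq, Pi.single_eq_of_ne hp, map_zero, sub_zero]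
        rw [e, inner_zero_right, mul_zero]

omit [Fintype X] [FiniteDimensional ℝ V] in
/-- … and that value vanishes for all v only if the charge f(x₁) does (c_b > 0, R(U) injective/onto; for a bond present
in both orientations under R(U(⟨x₁,x₀⟩)) = R(U(⟨x₀,x₁⟩))\*). [cite: Balaban1985BackgroundPropagators, (3.23) p. 394] -/
theorem eq_zero_of_near (τ : X → X → V →ₗ[ℝ] V) {bonds : Finset (X × X)} {cb : X × X → ℝ}
    (hcb : ∀ b ∈ bonds, 0 < cb b) {x₀ x₁ : X} (hadj : (x₀, x₁) ∈ bonds ∨ (x₁, x₀) ∈ bonds)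
    (hcompat : (x₀, x₁) ∈ bonds → (x₁, x₀) ∈ bonds → ∀ u v : V, ⟪τ x₀ x₁ u, v⟫_ℝ = ⟪u, τ x₁ x₀ v⟫_ℝ)
    (hinj01 : Function.Injective (τ x₀ x₁)) (hsurj10 : Function.Surjective (τ x₁ x₀)) (u : V)
    (h : ∀ v : V, (if (x₀, x₁) ∈ bonds then cb (x₀, x₁) * ⟪τ x₀ x₁ u, v⟫_ℝ else 0)
      + (if (x₁, x₀) ∈ bonds then cb (x₁, x₀) * ⟪u, τ x₁ x₀ v⟫_ℝ else 0) = 0) : u = 0 := by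
  by_cases h01 : (x₀, x₁) ∈ bonds
  · have h0 : τ x₀ x₁ u = 0 := by
      by_cases h10 : (x₁, x₀) ∈ bonds
      · have key := h (τ x₀ x₁ u)
        rw [if_pos h01, if_pos h10, ← hcompat h01 h10 u, ← add_mul, mul_eq_zero] at key
        rcases key with k | k
        · exact absurd k (add_pos (hcb _ h01) (hcb _ h10)).ne'
        · exact inner_self_eq_zero.mp k
      · have key := h (τ x₀ x₁ u)
        rw [if_pos h01, if_neg h10, add_zero, mul_eq_zero] at key
        rcases key with k | k
        · exact absurd k (hcb _ h01).ne'
        · exact inner_self_eq_zero.mp k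
    exact hinj01 (by rw [h0, map_zero])
  · have h10 : (x₁, x₀) ∈ bonds := hadj.resolve_left h01
    obtain ⟨v, hv⟩ := hsurj10 u
    have key := h v
    rw [if_neg h01, if_pos h10, zero_add, mul_eq_zero, hv] at key
    rcases key with k | k
    · exact absurd k (hcb _ h10).ne'
    · exact inner_self_eq_zero.mp k

end Single

/-! ## §2  The abstract theorem: two adjacent blocks, one far site ⟹ the criterion fails, at every background -/

section Abstract

variable {X : Type*} {Y : Type*} {V : Type*} [NormedAddCommGroup V] [InnerProductSpace ℝ V]
variable [Fintype X] [DecidableEq X] [FiniteDimensional ℝ V]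
variable (τ : X → X → V →ₗ[ℝ] V) {bonds : Finset (X × X)} (cb : X × X → ℝ) (w : Y → X → ℝ) (B : Y → Finset X)
  (Γ : Y → X → List X) (y : Y → X)

/-- **Q′ΔN(Q′) ≠ 0 at EVERY background.**  If blocks c ≠ c′ carry sites x₀ ∈ B(c), x₁, x₂ ∈ B(c′) (x₁ ≠ x₂, lying in
no other block, block weights w(c,x₀), w(c′,x₂) ≠ 0) such that ⟨x₀,x₁⟩ is a bond (either orientation), x₀ is the only
site of B(c) bonded to x₁, and no site of B(c) is bonded to x₂, then for every background with injective transports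
and positive bond weights some λ ∈ N(Q′) has Q′Δλ ≠ 0 — whatever the contours and centres.
[cite: Balaban1985BackgroundPropagators, (3.19) p. 393, (3.23) p. 394, (3.162)–(3.165) p. 429;
Balaban1985RegularSpaces, (1.91) p. 91] -/
theorem not_criterion_of_adjacent_blocks [Nontrivial V] (hinj : ∀ x x' : X, Function.Injective (τ x x'))
    (hcb : ∀ b ∈ bonds, 0 < cb b) {c c' : Y} {x₀ x₁ x₂ : X} (hc : c ≠ c') (hx₀ : x₀ ∈ B c) (hx₁ : x₁ ∈ B c')
    (hx₂ : x₂ ∈ B c') (h12 : x₁ ≠ x₂) (honly₁ : ∀ c'', x₁ ∈ B c'' → c'' = c')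
    (honly₂ : ∀ c'', x₂ ∈ B c'' → c'' = c') (hw₀ : w c x₀ ≠ 0) (hw₂ : w c' x₂ ≠ 0)
    (hadj : (x₀, x₁) ∈ bonds ∨ (x₁, x₀) ∈ bonds)
    (hcompat : (x₀, x₁) ∈ bonds → (x₁, x₀) ∈ bonds → ∀ u v : V, ⟪τ x₀ x₁ u, v⟫_ℝ = ⟪u, τ x₁ x₀ v⟫_ℝ)
    (huniq : ∀ x ∈ B c, ((x, x₁) ∈ bonds ∨ (x₁, x) ∈ bonds) → x = x₀)
    (hfar : ∀ x ∈ B c, (x, x₂) ∉ bonds ∧ (x₂, x) ∉ bonds) :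
    ¬ ∀ f : PiLp 2 (fun _ : X => V), qL τ w B Γ y f = 0 → qL τ w B Γ y (lapL τ bonds cb f) = 0 := by
  intro hcrit
  have hcb0 : ∀ b ∈ bonds, 0 ≤ cb b := fun b hb => (hcb b hb).le
  have hx₁c : x₁ ∉ B c := fun h => hc (honly₁ c h)
  have hx₂c : x₂ ∉ B c := fun h => hc (honly₂ c h)
  have h01 : x₀ ≠ x₁ := fun h => hx₁c (h ▸ hx₀)
  have h02 : x₀ ≠ x₂ := fun h => hx₂c (h ▸ hx₀)
  obtain ⟨v₁, hv₁⟩ := exists_ne (0 : V)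
  have hsurj₂ : Function.Surjective (pathTr τ (y c' :: Γ c' x₂)) :=
    LinearMap.injective_iff_surjective.mp (pathTr_injective hinj _)
  obtain ⟨v₂, hv₂⟩ := hsurj₂ ((w c' x₂)⁻¹ • -(w c' x₁ • pathTr τ (y c' :: Γ c' x₁) v₁))
  set f : PiLp 2 (fun _ : X => V) := single x₁ v₁ + single x₂ v₂ with hf
  have hfx : ∀ x, f x = (if x = x₁ then v₁ else 0) + (if x = x₂ then v₂ else 0) := fun x => by
    rw [hf, PiLp.add_apply, single_apply, single_apply]
  have hf1 : f x₁ = v₁ := by rw [hfx, if_pos rfl, if_neg h12, add_zero]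
  have hf0 : ∀ x, x ≠ x₁ → x ≠ x₂ → f x = 0 := fun x h1 h2 => by rw [hfx, if_neg h1, if_neg h2, add_zero]
  -- λ ∈ N(Q′)
  have hq : qL τ w B Γ y f = 0 := by
    ext c''
    rw [hf, map_add, PiLp.add_apply, qL_single, qL_single, PiLp.zero_apply]
    by_cases hc'' : c'' = c'
    · subst hc''
      rw [if_pos hx₁, if_pos hx₂, hv₂, smul_smul, mul_inv_cancel₀ hw₂, one_smul, add_neg_cancel]
    · rw [if_neg (fun h => hc'' (honly₁ _ h)), if_neg (fun h => hc'' (honly₂ _ h)), add_zero]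
  -- Δλ vanishes on B(c) away from x₀ …
  have hzero : ∀ x ∈ B c, x ≠ x₀ → lapL τ bonds cb f x = 0 := by
    intro x hx hne
    refine lapL_apply_eq_zero τ bonds cb hcb0 f x
      (hf0 x (fun h => hx₁c (h ▸ hx)) (fun h => hx₂c (h ▸ hx))) fun z hz => hf0 z ?_ ?_
    · rintro rfl
      exact hne (huniq x hx hz)
    · rintro rfl
      exact (hz.elim (hfar x hx).1 (hfar x hx).2).elim
  -- … so (Q′Δλ)(c) = w(c,x₀)·R(U(Γ))(Δλ)(x₀), which the criterion makes 0
  have hval : lapL τ bonds cb f x₀ = 0 := by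
    have h1 := congrArg (fun φ : PiLp 2 (fun _ : Y => V) => φ c) (hcrit f hq)
    simp only [PiLp.zero_apply] at h1
    rw [qL_apply] at h1
    unfold avgQ at h1
    rw [Finset.sum_eq_single_of_mem x₀ hx₀ fun x hx hne => by
      rw [show WithLp.ofLp (lapL τ bonds cb f) x = lapL τ bonds cb f x from rfl, hzero x hx hne, map_zero,
        smul_zero]] at h1
    rcases smul_eq_zero.mp h1 with h2 | h2
    · exact absurd h2 hw₀
    · exact pathTr_injective hinj _ (by rw [map_zero]; exact h2)
  -- read off the charge at x₁ from (Δλ)(x₀) = 0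
  have hnear := inner_lapL_apply_near τ bonds cb hcb0 f (Ne.symm h01) (hf0 x₀ h01 h02)
    (fun z hz1 hz => hf0 z hz1 (by rintro rfl; exact hz.elim (hfar x₀ hx₀).1 (hfar x₀ hx₀).2))
  have hzero₁ : f x₁ = 0 :=
    eq_zero_of_near τ hcb hadj hcompat (hinj x₀ x₁) (LinearMap.injective_iff_surjective.mp (hinj x₁ x₀)) (f x₁)
      fun v => by
        have h := hnear v
        rw [hval, inner_zero_left] at h
        linarith
  rw [hf1] at hzero₁
  exact hv₁ hzero₁

/-- **Hence (1.91)'s H′ ≠ [4]'s H′ of (3.163) at every such background**, for any (3.25)-data over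
(Δ_U, Q′(U), Q′(U)\*, a) with a onto. [cite: Balaban1985RegularSpaces, (1.91) p. 91;
Balaban1985BackgroundPropagators, (3.24)–(3.25) p. 394, (3.163)–(3.165) p. 429] -/
theorem exists_Hp_ne_H4_of_adjacent_blocks [Fintype Y] [Nontrivial V]
    (hinj : ∀ x x' : X, Function.Injective (τ x x')) (hcb : ∀ b ∈ bonds, 0 < cb b) {c c' : Y} {x₀ x₁ x₂ : X}
    (hc : c ≠ c') (hx₀ : x₀ ∈ B c) (hx₁ : x₁ ∈ B c') (hx₂ : x₂ ∈ B c') (h12 : x₁ ≠ x₂)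
    (honly₁ : ∀ c'', x₁ ∈ B c'' → c'' = c') (honly₂ : ∀ c'', x₂ ∈ B c'' → c'' = c') (hw₀ : w c x₀ ≠ 0)
    (hw₂ : w c' x₂ ≠ 0) (hadj : (x₀, x₁) ∈ bonds ∨ (x₁, x₀) ∈ bonds)
    (hcompat : (x₀, x₁) ∈ bonds → (x₁, x₀) ∈ bonds → ∀ u v : V, ⟪τ x₀ x₁ u, v⟫_ℝ = ⟪u, τ x₁ x₀ v⟫_ℝ)
    (huniq : ∀ x ∈ B c, ((x, x₁) ∈ bonds ∨ (x₁, x) ∈ bonds) → x = x₀)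
    (hfar : ∀ x ∈ B c, (x, x₂) ∉ bonds ∧ (x₂, x) ∉ bonds)
    {A : PiLp 2 (fun _ : Y => V) →ₗ[ℝ] PiLp 2 (fun _ : Y => V)}
    {g : PiLp 2 (fun _ : X => V) →ₗ[ℝ] PiLp 2 (fun _ : X => V)}
    {cc : PiLp 2 (fun _ : Y => V) →ₗ[ℝ] PiLp 2 (fun _ : Y => V)}
    (hdata : Data (lapL τ bonds cb) (qL τ w B Γ y) (LinearMap.adjoint (qL τ w B Γ y)) A g cc)
    (hA : Function.Surjective A) :
    ∃ μ, Hp (LinearMap.adjoint (qL τ w B Γ y)) g cc μ ≠ H4 (qL τ w B Γ y) (LinearMap.adjoint (qL τ w B Γ y)) A g cc μ := by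
  by_contra hall
  refine not_criterion_of_adjacent_blocks τ cb w B Γ y hinj hcb hc hx₀ hx₁ hx₂ h12 honly₁ honly₂ hw₀ hw₂ hadj hcompat
    huniq hfar (criterion_of_H4_eq_Hp hdata hA fun μ => ?_)
  by_contra hμ
  exact hall ⟨μ, fun e => hμ e.symm⟩

omit [Fintype X] [DecidableEq X] [FiniteDimensional ℝ V] in
/-- **One-site blocks: N(Q′) = 0** — if every block is a single site carrying a nonzero weight and the blocks cover,
Q′λ = 0 forces λ = 0, at every background. [cite: Balaban1985BackgroundPropagators, (3.19) p. 393, (3.21) p. 394] -/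
theorem eq_zero_of_qL_eq_zero_of_subsingleton (hinj : ∀ x x' : X, Function.Injective (τ x x'))
    (hsub : ∀ c, ∀ x ∈ B c, ∀ x' ∈ B c, x = x') (hcover : ∀ x, ∃ c, x ∈ B c)
    (hw : ∀ c, ∀ x ∈ B c, w c x ≠ 0) (f : PiLp 2 (fun _ : X => V)) (hf : qL τ w B Γ y f = 0) : f = 0 := by
  ext x
  obtain ⟨c, hx⟩ := hcover x
  have h1 := congrArg (fun φ : PiLp 2 (fun _ : Y => V) => φ c) hf
  simp only [PiLp.zero_apply] at h1
  rw [qL_apply] at h1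
  unfold avgQ at h1
  rw [Finset.sum_eq_single_of_mem x hx fun x' hx' hne => absurd (hsub c x' hx' x hx) hne] at h1
  rcases smul_eq_zero.mp h1 with h2 | h2
  · exact absurd h2 (hw c x hx)
  · rw [PiLp.zero_apply]
    exact pathTr_injective hinj _ (by rw [map_zero]; exact h2)

omit [DecidableEq X] in
/-- **… so the criterion Q′ΔN(Q′) = 0 holds trivially for one-site blocks, at every background** (the L = 1 case).
[cite: Balaban1985BackgroundPropagators, (3.19) p. 393, (3.23) p. 394; Balaban1985RegularSpaces, (1.91) p. 91] -/
theorem criterion_of_subsingleton_blocks (hinj : ∀ x x' : X, Function.Injective (τ x x'))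
    (hsub : ∀ c, ∀ x ∈ B c, ∀ x' ∈ B c, x = x') (hcover : ∀ x, ∃ c, x ∈ B c)
    (hw : ∀ c, ∀ x ∈ B c, w c x ≠ 0) :
    ∀ f : PiLp 2 (fun _ : X => V), qL τ w B Γ y f = 0 → qL τ w B Γ y (lapL τ bonds cb f) = 0 := by
  intro f hf
  rw [eq_zero_of_qL_eq_zero_of_subsingleton τ w B Γ y hinj hsub hcover hw f hf, map_zero, map_zero]

omit [DecidableEq X] in
/-- **One-site blocks: (1.91)'s H′ = [4]'s H′ for every background and every (3.25)-data.**
[cite: Balaban1985RegularSpaces, (1.91) p. 91; Balaban1985BackgroundPropagators, (3.163)–(3.165) p. 429] -/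
theorem H4_eq_Hp_of_subsingleton_blocks [Fintype Y] (hinj : ∀ x x' : X, Function.Injective (τ x x'))
    (hsub : ∀ c, ∀ x ∈ B c, ∀ x' ∈ B c, x = x') (hcover : ∀ x, ∃ c, x ∈ B c)
    (hw : ∀ c, ∀ x ∈ B c, w c x ≠ 0)
    {A : PiLp 2 (fun _ : Y => V) →ₗ[ℝ] PiLp 2 (fun _ : Y => V)}
    {g : PiLp 2 (fun _ : X => V) →ₗ[ℝ] PiLp 2 (fun _ : X => V)}
    {cc : PiLp 2 (fun _ : Y => V) →ₗ[ℝ] PiLp 2 (fun _ : Y => V)}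
    (hdata : Data (lapL τ bonds cb) (qL τ w B Γ y) (LinearMap.adjoint (qL τ w B Γ y)) A g cc) (μ : PiLp 2 (fun _ : Y => V)) :
    H4 (qL τ w B Γ y) (LinearMap.adjoint (qL τ w B Γ y)) A g cc μ = Hp (LinearMap.adjoint (qL τ w B Γ y)) g cc μ :=
  H4_eq_Hp_of_criterion hdata (criterion_of_subsingleton_blocks τ cb w B Γ y hinj hsub hcover hw) μ

end Abstract

/-! ## §3  The free box of parts 6/6b at every background -/

section Box

variable (d K l : ℕ) {V : Type*} [NormedAddCommGroup V] [InnerProductSpace ℝ V] [FiniteDimensional ℝ V]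

/-- membership in `blocksOf`. [folklore] -/
private theorem mem_blocksOf' {X Y : Type*} [Fintype X] [DecidableEq Y] (blk : X → Y) (c : Y) (x : X) :
    x ∈ blocksOf blk c ↔ blk x = c := by
  unfold blocksOf
  simp only [mem_filter, mem_univ, true_and]

/-- x lies in the cube c iff ⌊x_i / L⌋ = c_i for every axis. [cite: Balaban1985Averaging, (2) p. 17] -/
theorem mem_blocksOf_boxBlk_iff (x : Fin d → Fin (nSide K l)) (c : Fin d → Fin K) :
    x ∈ blocksOf (boxBlk (l + 1) K rfl) c ↔ ∀ i, (x i).val / (l + 1) = (c i).val := by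
  rw [mem_blocksOf']
  constructor
  · intro h i
    rw [← h, boxBlk_apply_val]
  · intro h
    funext i
    exact Fin.ext (by rw [boxBlk_apply_val]; exact h i)

/-- the site with coordinate n on axis i₀ and 0 on the other axes. [cite: Balaban1985Averaging, (2) p. 17] -/
def axisSite (i₀ : Fin d) (n : ℕ) (hn : n < nSide K l) : Fin d → Fin (nSide K l) :=
  fun i => if i = i₀ then ⟨n, hn⟩ else ⟨0, lt_of_le_of_lt (Nat.zero_le n) hn⟩

/-- the block index with m on axis i₀ and 0 on the other axes. [cite: Balaban1985Averaging, (2) p. 17] -/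
def axisBlk (i₀ : Fin d) (m : ℕ) (hm : m < K) : Fin d → Fin K :=
  fun i => if i = i₀ then ⟨m, hm⟩ else ⟨0, lt_of_le_of_lt (Nat.zero_le m) hm⟩

/-- coordinates of `axisSite`. [folklore] -/
private theorem axisSite_val (i₀ : Fin d) (n : ℕ) (hn : n < nSide K l) (i : Fin d) :
    (axisSite d K l i₀ n hn i).val = if i = i₀ then n else 0 := by
  unfold axisSite
  split_ifs <;> rfl

/-- coordinates of `axisBlk`. [folklore] -/
private theorem axisBlk_val (i₀ : Fin d) (m : ℕ) (hm : m < K) (i : Fin d) :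
    (axisBlk d K i₀ m hm i).val = if i = i₀ then m else 0 := by
  unfold axisBlk
  split_ifs <;> rfl

/-- `axisSite n` lies in the cube `axisBlk m` iff ⌊n / L⌋ = m. [cite: Balaban1985Averaging, (2) p. 17] -/
theorem axisSite_mem_iff (i₀ : Fin d) (n : ℕ) (hn : n < nSide K l) (m : ℕ) (hm : m < K) :
    axisSite d K l i₀ n hn ∈ blocksOf (boxBlk (l + 1) K rfl) (axisBlk d K i₀ m hm) ↔ n / (l + 1) = m := by
  rw [mem_blocksOf_boxBlk_iff]
  constructor
  · intro h
    have h0 := h i₀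
    rwa [axisSite_val, axisBlk_val, if_pos rfl, if_pos rfl] at h0
  · intro h i
    rw [axisSite_val, axisBlk_val]
    split_ifs
    · exact h
    · exact Nat.zero_div _

/-- The cube containing a site is unique (the cubes partition the box). [folklore] -/
private theorem blk_eq_of_mem {x : Fin d → Fin (nSide K l)} {c c' : Fin d → Fin K}
    (h : x ∈ blocksOf (boxBlk (l + 1) K rfl) c) (h' : x ∈ blocksOf (boxBlk (l + 1) K rfl) c') : c = c' :=
  ((mem_blocksOf' _ _ _).1 h).symm.trans ((mem_blocksOf' _ _ _).1 h')

/-- **The free box, L = l + 1 ≥ 2, K ≥ 2, d ≥ 1: the criterion Q′ΔN(Q′) = 0 FAILS AT EVERY BACKGROUND** — any injective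
transports, any positive bond weights, any block weights ≠ 0, any contours and centres.
[cite: Balaban1985RegularSpaces, (1.91) p. 91; Balaban1985BackgroundPropagators, (3.19) p. 393, (3.23) p. 394;
Balaban1985Averaging, (2) p. 17] -/
theorem not_criterion_box (hd : 0 < d) (hl : 1 ≤ l) (hK : 2 ≤ K) [Nontrivial V]
    (τ : (Fin d → Fin (nSide K l)) → (Fin d → Fin (nSide K l)) → V →ₗ[ℝ] V)
    (hinj : ∀ x x', Function.Injective (τ x x'))
    {cb : (Fin d → Fin (nSide K l)) × (Fin d → Fin (nSide K l)) → ℝ}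
    (hcb : ∀ b ∈ boxBonds (Fin d) (nSide K l), 0 < cb b)
    {w : (Fin d → Fin K) → (Fin d → Fin (nSide K l)) → ℝ}
    (hw : ∀ c, ∀ x ∈ blocksOf (boxBlk (l + 1) K rfl) c, w c x ≠ 0)
    (Γ : (Fin d → Fin K) → (Fin d → Fin (nSide K l)) → List (Fin d → Fin (nSide K l)))
    (y : (Fin d → Fin K) → Fin d → Fin (nSide K l)) :
    ¬ ∀ f, qL τ w (blocksOf (boxBlk (l + 1) K rfl)) Γ y f = 0 →
        qL τ w (blocksOf (boxBlk (l + 1) K rfl)) Γ y (lapL τ (boxBonds (Fin d) (nSide K l)) cb f) = 0 := by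
  set i₀ : Fin d := ⟨0, hd⟩ with hi₀
  have hK2 : (l + 1) * 2 ≤ nSide K l := Nat.mul_le_mul_left (l + 1) hK
  have hn0 : l + 1 < nSide K l := lt_of_lt_of_le (by omega) hK2
  have hn1 : l < nSide K l := lt_trans (Nat.lt_succ_self l) hn0
  have hn2 : 0 < nSide K l := lt_of_le_of_lt (Nat.zero_le l) hn1
  have hK0 : 0 < K := by omega
  have hK1 : 1 < K := by omega
  -- the cast: c′ = 0, c = e_{i₀}; x₂ = 0, x₁ = l e_{i₀}, x₀ = (l+1) e_{i₀}
  set c' := axisBlk d K i₀ 0 hK0 with hc'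
  set c := axisBlk d K i₀ 1 hK1 with hc
  set x₂ := axisSite d K l i₀ 0 hn2 with hx₂
  set x₁ := axisSite d K l i₀ l hn1 with hx₁
  set x₀ := axisSite d K l i₀ (l + 1) hn0 with hx₀
  have mx₀ : x₀ ∈ blocksOf (boxBlk (l + 1) K rfl) c := (axisSite_mem_iff d K l i₀ _ hn0 1 hK1).2 (Nat.div_self l.succ_pos)
  have mx₁ : x₁ ∈ blocksOf (boxBlk (l + 1) K rfl) c' :=
    (axisSite_mem_iff d K l i₀ _ hn1 0 hK0).2 (Nat.div_eq_of_lt (Nat.lt_succ_self l))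
  have mx₂ : x₂ ∈ blocksOf (boxBlk (l + 1) K rfl) c' := (axisSite_mem_iff d K l i₀ _ hn2 0 hK0).2 (Nat.zero_div _)
  have hcc : c ≠ c' := by
    intro h
    have h1 := congrArg (fun e : Fin d → Fin K => (e i₀).val) h
    rw [hc, hc', axisBlk_val, axisBlk_val, if_pos rfl, if_pos rfl] at h1
    exact one_ne_zero h1
  have h12 : x₁ ≠ x₂ := by
    intro h
    have h1 := congrArg (fun e : Fin d → Fin (nSide K l) => (e i₀).val) h
    rw [hx₁, hx₂, axisSite_val, axisSite_val, if_pos rfl, if_pos rfl] at h1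
    omega
  -- sites of the cube c have i₀-coordinate ≥ L
  have memc : ∀ x ∈ blocksOf (boxBlk (l + 1) K rfl) c, l + 1 ≤ (x i₀).val := by
    intro x hx
    have h1 := (mem_blocksOf_boxBlk_iff d K l x c).1 hx i₀
    rw [hc, axisBlk_val, if_pos rfl] at h1
    by_contra hlt
    rw [Nat.div_eq_of_lt (by omega)] at h1
    exact zero_ne_one h1
  refine not_criterion_of_adjacent_blocks τ cb w (blocksOf (boxBlk (l + 1) K rfl)) Γ y hinj hcb hcc mx₀ mx₁ mx₂ h12
    (fun c'' h => (blk_eq_of_mem d K l h mx₁)) (fun c'' h => (blk_eq_of_mem d K l h mx₂)) (hw c x₀ mx₀)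
    (hw c' x₂ mx₂) ?_ ?_ ?_ ?_
  · -- ⟨x₁, x₀⟩ = ⟨x₁, x₁ + e_{i₀}⟩ is a box bond
    refine Or.inr ((mem_boxBonds x₁ x₀).2 ⟨i₀, ?_, fun j hj => Fin.ext ?_⟩)
    · rw [hx₀, hx₁, axisSite_val, axisSite_val, if_pos rfl, if_pos rfl]
    · rw [hx₀, hx₁, axisSite_val, axisSite_val, if_neg hj, if_neg hj]
  · -- the reverse orientation is not a box bond (vacuous compatibility)
    intro h01
    obtain ⟨i, hi, -⟩ := (mem_boxBonds x₀ x₁).1 h01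
    rw [hx₀, hx₁, axisSite_val, axisSite_val] at hi
    exfalso
    by_cases hii : i = i₀
    · rw [if_pos hii, if_pos hii] at hi
      omega
    · rw [if_neg hii, if_neg hii] at hi
      omega
  · -- x₀ is the only site of the cube c bonded to x₁
    intro x hx hb
    have hge := memc x hx
    rcases hb with hb | hb
    · obtain ⟨i, hi, hrest⟩ := (mem_boxBonds x x₁).1 hb
      exfalso
      by_cases hii : i = i₀
      · subst hii
        rw [hx₁, axisSite_val, if_pos rfl] at hi
        omega
      · have h1 := congrArg Fin.val (hrest i₀ (Ne.symm hii))
        rw [hx₁, axisSite_val, if_pos rfl] at h1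
        omega
    · obtain ⟨i, hi, hrest⟩ := (mem_boxBonds x₁ x).1 hb
      by_cases hii : i = i₀
      · subst hii
        rw [hx₁, axisSite_val, if_pos rfl] at hi
        funext j
        apply Fin.ext
        rw [hx₀, axisSite_val]
        by_cases hj : j = i₀
        · subst hj
          rw [if_pos rfl]
          exact hi
        · rw [if_neg hj, hrest j hj, hx₁, axisSite_val, if_neg hj]
      · exfalso
        have h1 := congrArg Fin.val (hrest i₀ (Ne.symm hii))
        rw [hx₁, axisSite_val, if_pos rfl] at h1
        omega
  · -- no site of the cube c is bonded to the corner x₂ = 0 of c′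
    intro x hx
    have hge := memc x hx
    constructor
    · intro hb
      obtain ⟨i, hi, -⟩ := (mem_boxBonds x x₂).1 hb
      rw [hx₂, axisSite_val] at hi
      by_cases hii : i = i₀
      · rw [if_pos hii] at hi
        omega
      · rw [if_neg hii] at hi
        omega
    · intro hb
      obtain ⟨i, hi, hrest⟩ := (mem_boxBonds x₂ x).1 hb
      by_cases hii : i = i₀
      · subst hii
        rw [hx₂, axisSite_val, if_pos rfl] at hi
        omega
      · have h1 := congrArg Fin.val (hrest i₀ (Ne.symm hii))
        rw [hx₂, axisSite_val, if_pos rfl] at h1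
        omega

omit [FiniteDimensional ℝ V] in
/-- a = diag(a_c) with a_c ≠ 0 is onto on the 𝔤-valued block functions (as in part 7's `AL_surjectiveV`).
[cite: Balaban1985BackgroundPropagators, (3.24) p. 394] -/
private theorem AL_surjectiveV' {Y : Type*} (a : Y → ℝ) (ha : ∀ c, a c ≠ 0) : Function.Surjective (AL (V := V) a) := by
  intro φ
  refine ⟨WithLp.toLp 2 (fun c => (a c)⁻¹ • WithLp.ofLp φ c), ?_⟩
  ext c
  rw [AL_apply]
  show a c • ((a c)⁻¹ • WithLp.ofLp φ c) = WithLp.ofLp φ c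
  rw [smul_smul, mul_inv_cancel₀ (ha c), one_smul]

/-- **The free box, L ≥ 2, K ≥ 2, d ≥ 1, EVERY background: (1.91)'s H′ ≠ [4]'s H′ (3.163)** for every (3.25)-data
with a = diag(a_c), a_c ≠ 0 (any contours/centres, block weights ≠ 0, bond weights > 0).
[cite: Balaban1985RegularSpaces, (1.91) p. 91; Balaban1985BackgroundPropagators, (3.24)–(3.25) p. 394,
(3.163)–(3.165) p. 429] -/
theorem Hp_ne_H4_box_background (hd : 0 < d) (hl : 1 ≤ l) (hK : 2 ≤ K) [Nontrivial V]
    (τ : (Fin d → Fin (nSide K l)) → (Fin d → Fin (nSide K l)) → V →ₗ[ℝ] V)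
    (hinj : ∀ x x', Function.Injective (τ x x'))
    {cb : (Fin d → Fin (nSide K l)) × (Fin d → Fin (nSide K l)) → ℝ}
    (hcb : ∀ b ∈ boxBonds (Fin d) (nSide K l), 0 < cb b)
    {w : (Fin d → Fin K) → (Fin d → Fin (nSide K l)) → ℝ}
    (hw : ∀ c, ∀ x ∈ blocksOf (boxBlk (l + 1) K rfl) c, w c x ≠ 0)
    (Γ : (Fin d → Fin K) → (Fin d → Fin (nSide K l)) → List (Fin d → Fin (nSide K l)))
    (y : (Fin d → Fin K) → Fin d → Fin (nSide K l)) (a : (Fin d → Fin K) → ℝ) (ha : ∀ c, a c ≠ 0)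
    {g : PiLp 2 (fun _ : Fin d → Fin (nSide K l) => V) →ₗ[ℝ] PiLp 2 (fun _ : Fin d → Fin (nSide K l) => V)}
    {cc : PiLp 2 (fun _ : Fin d → Fin K => V) →ₗ[ℝ] PiLp 2 (fun _ : Fin d → Fin K => V)}
    (hdata : Data (lapL τ (boxBonds (Fin d) (nSide K l)) cb) (qL τ w (blocksOf (boxBlk (l + 1) K rfl)) Γ y)
      (LinearMap.adjoint (qL τ w (blocksOf (boxBlk (l + 1) K rfl)) Γ y)) (AL a) g cc) :
    ∃ μ, Hp (LinearMap.adjoint (qL τ w (blocksOf (boxBlk (l + 1) K rfl)) Γ y)) g cc μ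
      ≠ H4 (qL τ w (blocksOf (boxBlk (l + 1) K rfl)) Γ y)
          (LinearMap.adjoint (qL τ w (blocksOf (boxBlk (l + 1) K rfl)) Γ y)) (AL a) g cc μ := by
  by_contra hall
  refine not_criterion_box d K l hd hl hK τ hinj hcb hw Γ y
    (criterion_of_H4_eq_Hp hdata (AL_surjectiveV' a ha) fun μ => ?_)
  by_contra hμ
  exact hall ⟨μ, fun e => hμ e.symm⟩

/-- **Hypothesis-free: on the printed cubes (corner centres, axis-by-axis contours, uniform κ ≠ 0, unit bond weights)
the (3.25)-data EXIST AT EVERY BACKGROUND and (1.91)'s H′ ≠ [4]'s H′ on them** (L ≥ 2, K ≥ 2, d ≥ 1) — the letters of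
record `gL`, (Q′G′²Q′\*)⁻¹ = `cL` ([4] Thm 3.11 «obvious») at the transports τ.
[cite: Balaban1985RegularSpaces, (1.91) p. 91; Balaban1985BackgroundPropagators, (3.18)–(3.19) p. 393,
(3.24)–(3.25) p. 394, Thm 3.11 p. 416, (3.163)–(3.165) p. 429] -/
theorem exists_data_Hp_ne_H4_box_background (hd : 0 < d) (hl : 1 ≤ l) (hK : 2 ≤ K) [Nontrivial V]
    (τ : (Fin d → Fin (nSide K l)) → (Fin d → Fin (nSide K l)) → V →ₗ[ℝ] V)
    (hinj : ∀ x x', Function.Injective (τ x x')) {κ : ℝ} (hκ : κ ≠ 0) (a : (Fin d → Fin K) → ℝ)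
    (ha : ∀ c, 0 < a c) :
    ∃ (g : PiLp 2 (fun _ : Fin d → Fin (nSide K l) => V) →ₗ[ℝ] PiLp 2 (fun _ : Fin d → Fin (nSide K l) => V))
      (cc : PiLp 2 (fun _ : Fin d → Fin K => V) →ₗ[ℝ] PiLp 2 (fun _ : Fin d → Fin K => V)),
      Data (lapL τ (boxBonds (Fin d) (nSide K l)) (fun _ => 1))
          (qL τ (fun _ _ => κ) (blocksOf (boxBlk (l + 1) K rfl)) (ΓBox d K l) (yBox d K l))
          (LinearMap.adjoint (qL τ (fun _ _ => κ) (blocksOf (boxBlk (l + 1) K rfl)) (ΓBox d K l) (yBox d K l)))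
          (AL a) g cc ∧
        ∃ μ, Hp (LinearMap.adjoint (qL τ (fun _ _ => κ) (blocksOf (boxBlk (l + 1) K rfl)) (ΓBox d K l) (yBox d K l)))
            g cc μ
          ≠ H4 (qL τ (fun _ _ => κ) (blocksOf (boxBlk (l + 1) K rfl)) (ΓBox d K l) (yBox d K l))
              (LinearMap.adjoint (qL τ (fun _ _ => κ) (blocksOf (boxBlk (l + 1) K rfl)) (ΓBox d K l) (yBox d K l)))
              (AL a) g cc μ := by
  have hcb : ∀ b ∈ boxBonds (Fin d) (nSide K l), (0 : ℝ) < (fun _ => (1 : ℝ)) b := fun _ _ => one_pos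
  have hS := isBlockSystem_box d K l hκ
  exact ⟨gL τ (fun _ => 1) a hinj hcb hS ha, cL τ (fun _ => 1) a hinj hcb hS ha, data_L hinj hcb hS ha,
    Hp_ne_H4_box_background d K l hd hl hK τ hinj hcb (fun _ _ _ => hκ) _ _ a (fun c => (ha c).ne')
      (data_L hinj hcb hS ha)⟩

/-- **The free box with L = 1 (one-site cubes), EVERY background: (1.91)'s H′ = [4]'s H′** for every (3.25)-data (any
K, d, bond weights, block weights ≠ 0, contours, centres). [cite: Balaban1985RegularSpaces, (1.91) p. 91;
Balaban1985BackgroundPropagators, (3.19) p. 393, (3.163)–(3.165) p. 429] -/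
theorem H4_eq_Hp_box_L1 (τ : (Fin d → Fin (nSide K 0)) → (Fin d → Fin (nSide K 0)) → V →ₗ[ℝ] V)
    (hinj : ∀ x x', Function.Injective (τ x x'))
    (cb : (Fin d → Fin (nSide K 0)) × (Fin d → Fin (nSide K 0)) → ℝ)
    {w : (Fin d → Fin K) → (Fin d → Fin (nSide K 0)) → ℝ}
    (hw : ∀ c, ∀ x ∈ blocksOf (boxBlk (0 + 1) K rfl) c, w c x ≠ 0)
    (Γ : (Fin d → Fin K) → (Fin d → Fin (nSide K 0)) → List (Fin d → Fin (nSide K 0)))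
    (y : (Fin d → Fin K) → Fin d → Fin (nSide K 0))
    {A : PiLp 2 (fun _ : Fin d → Fin K => V) →ₗ[ℝ] PiLp 2 (fun _ : Fin d → Fin K => V)}
    {g : PiLp 2 (fun _ : Fin d → Fin (nSide K 0) => V) →ₗ[ℝ] PiLp 2 (fun _ : Fin d → Fin (nSide K 0) => V)}
    {cc : PiLp 2 (fun _ : Fin d → Fin K => V) →ₗ[ℝ] PiLp 2 (fun _ : Fin d → Fin K => V)}
    (hdata : Data (lapL τ (boxBonds (Fin d) (nSide K 0)) cb) (qL τ w (blocksOf (boxBlk (0 + 1) K rfl)) Γ y)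
      (LinearMap.adjoint (qL τ w (blocksOf (boxBlk (0 + 1) K rfl)) Γ y)) A g cc)
    (μ : PiLp 2 (fun _ : Fin d → Fin K => V)) :
    H4 (qL τ w (blocksOf (boxBlk (0 + 1) K rfl)) Γ y) (LinearMap.adjoint (qL τ w (blocksOf (boxBlk (0 + 1) K rfl)) Γ y))
        A g cc μ
      = Hp (LinearMap.adjoint (qL τ w (blocksOf (boxBlk (0 + 1) K rfl)) Γ y)) g cc μ := by
  refine H4_eq_Hp_of_subsingleton_blocks τ cb w _ Γ y hinj (fun c x hx x' hx' => ?_)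
    (fun x => ⟨boxBlk (0 + 1) K rfl x, (mem_blocksOf' _ _ x).2 rfl⟩) hw hdata μ
  have h := (mem_blocksOf_boxBlk_iff d K 0 x c).1 hx
  have h' := (mem_blocksOf_boxBlk_iff d K 0 x' c).1 hx'
  funext i
  apply Fin.ext
  have hi := h i
  have hi' := h' i
  rw [Nat.div_one] at hi hi'
  rw [hi, hi']

end Box

/-! ## §4  The torus of parts 2/6 at every background -/

section Torus

variable (d K l : ℕ) {V : Type*} [NormedAddCommGroup V] [InnerProductSpace ℝ V] [FiniteDimensional ℝ V]

/-- **The torus (ℤ/(LK))^d with the cubes of side L = l + 1, K ≥ 2, and K ≥ 3 or L ≥ 3 (so (L, K) ≠ (2, 2)), d ≥ 1: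
the criterion Q′ΔN(Q′) = 0 FAILS AT EVERY BACKGROUND** (any injective transports, bond weights > 0, block weights ≠ 0,
contours, centres).  At (L, K) = (2, 2) every site of a cube is bonded to the neighbouring cube, the abstract theorem
does not apply, and the flat criterion holds (part 2); that case is not treated. [cite: Balaban1985RegularSpaces, (1.91) p. 91,
p. 77 (T_η); Balaban1985BackgroundPropagators, (3.19) p. 393, (3.23) p. 394; Balaban1985Averaging, (2) p. 17] -/
theorem not_criterion_torus (hd : 0 < d) (hl : 1 ≤ l) (hK : 2 ≤ K) (h3 : 3 ≤ K ∨ 2 ≤ l) [Nontrivial V]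
    (τ : (Fin d → Fin (nSide K l)) → (Fin d → Fin (nSide K l)) → V →ₗ[ℝ] V)
    (hinj : ∀ x x', Function.Injective (τ x x'))
    {cb : (Fin d → Fin (nSide K l)) × (Fin d → Fin (nSide K l)) → ℝ}
    (hcb : ∀ b ∈ torusBonds (Fin d) (nSide K l), 0 < cb b)
    {w : (Fin d → Fin K) → (Fin d → Fin (nSide K l)) → ℝ}
    (hw : ∀ c, ∀ x ∈ blocksOf (boxBlk (l + 1) K rfl) c, w c x ≠ 0)
    (Γ : (Fin d → Fin K) → (Fin d → Fin (nSide K l)) → List (Fin d → Fin (nSide K l)))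
    (y : (Fin d → Fin K) → Fin d → Fin (nSide K l)) :
    ¬ ∀ f, qL τ w (blocksOf (boxBlk (l + 1) K rfl)) Γ y f = 0 →
        qL τ w (blocksOf (boxBlk (l + 1) K rfl)) Γ y (lapL τ (torusBonds (Fin d) (nSide K l)) cb f) = 0 := by
  set i₀ : Fin d := ⟨0, hd⟩ with hi₀
  have hK2 : (l + 1) * 2 ≤ nSide K l := Nat.mul_le_mul_left (l + 1) hK
  have hn0 : l + 1 < nSide K l := lt_of_lt_of_le (by omega) hK2
  have hn1 : l < nSide K l := lt_trans (Nat.lt_succ_self l) hn0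
  have hn2 : 0 < nSide K l := lt_of_le_of_lt (Nat.zero_le l) hn1
  have hn3 : 1 < nSide K l := by omega
  have hK0 : 0 < K := by omega
  have hK1 : 1 < K := by omega
  set c' := axisBlk d K i₀ 0 hK0 with hc'
  set c := axisBlk d K i₀ 1 hK1 with hc
  set x₁ := axisSite d K l i₀ l hn1 with hx₁
  set x₀ := axisSite d K l i₀ (l + 1) hn0 with hx₀
  have mx₀ : x₀ ∈ blocksOf (boxBlk (l + 1) K rfl) c := (axisSite_mem_iff d K l i₀ _ hn0 1 hK1).2 (Nat.div_self l.succ_pos)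
  have mx₁ : x₁ ∈ blocksOf (boxBlk (l + 1) K rfl) c' :=
    (axisSite_mem_iff d K l i₀ _ hn1 0 hK0).2 (Nat.div_eq_of_lt (Nat.lt_succ_self l))
  have hcc : c ≠ c' := by
    intro h
    have h1 := congrArg (fun e : Fin d → Fin K => (e i₀).val) h
    rw [hc, hc', axisBlk_val, axisBlk_val, if_pos rfl, if_pos rfl] at h1
    exact one_ne_zero h1
  -- sites of the cube c have i₀-coordinate in [L, 2L)
  have memc : ∀ x ∈ blocksOf (boxBlk (l + 1) K rfl) c, l + 1 ≤ (x i₀).val ∧ (x i₀).val < (l + 1) * 2 := by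
    intro x hx
    have h1 := (mem_blocksOf_boxBlk_iff d K l x c).1 hx i₀
    rw [hc, axisBlk_val, if_pos rfl] at h1
    constructor
    · by_contra hlt
      rw [Nat.div_eq_of_lt (by omega)] at h1
      exact zero_ne_one h1
    · have h2 : (x i₀).val / (l + 1) < 2 := by
        rw [h1]
        exact Nat.one_lt_two
      have h3 := (Nat.div_lt_iff_lt_mul l.succ_pos).1 h2
      omega
  -- a site x₂ of the cube c′ with no torus bond to the cube c: the origin if K ≥ 3, the site e_{i₀} if L ≥ 3
  obtain ⟨x₂, mx₂, h12, hfar⟩ : ∃ x₂, x₂ ∈ blocksOf (boxBlk (l + 1) K rfl) c' ∧ x₁ ≠ x₂ ∧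
      ∀ x ∈ blocksOf (boxBlk (l + 1) K rfl) c,
        (x, x₂) ∉ torusBonds (Fin d) (nSide K l) ∧ (x₂, x) ∉ torusBonds (Fin d) (nSide K l) := by
    rcases h3 with h3 | h3
    · have hK3 : (l + 1) * 3 ≤ nSide K l := Nat.mul_le_mul_left (l + 1) h3
      refine ⟨axisSite d K l i₀ 0 hn2, (axisSite_mem_iff d K l i₀ _ hn2 0 hK0).2 (Nat.zero_div _), ?_, ?_⟩
      · intro h
        have h1 := congrArg (fun e : Fin d → Fin (nSide K l) => (e i₀).val) h
        rw [hx₁, axisSite_val, axisSite_val, if_pos rfl, if_pos rfl] at h1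
        omega
      · intro x hx
        obtain ⟨hge, hlt⟩ := memc x hx
        constructor
        · intro hb
          obtain ⟨i, hi, hrest⟩ := (mem_torusBonds x _).1 hb
          by_cases hii : i = i₀
          · subst hii
            rw [axisSite_val, if_pos rfl] at hi
            -- 0 = (x_{i₀} + 1) % N with L ≤ x_{i₀} < 2L ≤ N and N ≥ 3L
            by_cases hN : (x i₀).val + 1 < nSide K l
            · rw [Nat.mod_eq_of_lt hN] at hi
              omega
            · have hN' : (x i₀).val + 1 = nSide K l := by omega
              omega
          · have h1 := congrArg Fin.val (hrest i₀ (Ne.symm hii))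
            rw [axisSite_val, if_pos rfl] at h1
            omega
        · intro hb
          obtain ⟨i, hi, hrest⟩ := (mem_torusBonds _ x).1 hb
          by_cases hii : i = i₀
          · subst hii
            rw [axisSite_val, if_pos rfl, Nat.mod_eq_of_lt (by omega)] at hi
            omega
          · have h1 := congrArg Fin.val (hrest i₀ (Ne.symm hii))
            rw [axisSite_val, if_pos rfl] at h1
            omega
    · refine ⟨axisSite d K l i₀ 1 hn3, (axisSite_mem_iff d K l i₀ _ hn3 0 hK0).2 (Nat.div_eq_of_lt (by omega)), ?_, ?_⟩
      · intro h
        have h1 := congrArg (fun e : Fin d → Fin (nSide K l) => (e i₀).val) h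
        rw [hx₁, axisSite_val, axisSite_val, if_pos rfl, if_pos rfl] at h1
        omega
      · intro x hx
        obtain ⟨hge, hlt⟩ := memc x hx
        constructor
        · intro hb
          obtain ⟨i, hi, hrest⟩ := (mem_torusBonds x _).1 hb
          by_cases hii : i = i₀
          · subst hii
            rw [axisSite_val, if_pos rfl] at hi
            by_cases hN : (x i₀).val + 1 < nSide K l
            · rw [Nat.mod_eq_of_lt hN] at hi
              omega
            · have hN' : (x i₀).val + 1 = nSide K l := by omega
              rw [hN', Nat.mod_self] at hi
              omega
          · have h1 := congrArg Fin.val (hrest i₀ (Ne.symm hii))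
            rw [axisSite_val, if_pos rfl] at h1
            omega
        · intro hb
          obtain ⟨i, hi, hrest⟩ := (mem_torusBonds _ x).1 hb
          by_cases hii : i = i₀
          · subst hii
            rw [axisSite_val, if_pos rfl, Nat.mod_eq_of_lt (by omega)] at hi
            omega
          · have h1 := congrArg Fin.val (hrest i₀ (Ne.symm hii))
            rw [axisSite_val, if_pos rfl] at h1
            omega
  refine not_criterion_of_adjacent_blocks τ cb w (blocksOf (boxBlk (l + 1) K rfl)) Γ y hinj hcb hcc mx₀ mx₁ mx₂ h12
    (fun c'' h => (blk_eq_of_mem d K l h mx₁)) (fun c'' h => (blk_eq_of_mem d K l h mx₂)) (hw c x₀ mx₀)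
    (hw c' x₂ mx₂) ?_ ?_ ?_ hfar
  · -- ⟨x₁, x₀⟩ is a torus bond
    refine Or.inr ((mem_torusBonds x₁ x₀).2 ⟨i₀, ?_, fun j hj => Fin.ext ?_⟩)
    · rw [hx₀, hx₁, axisSite_val, axisSite_val, if_pos rfl, if_pos rfl, Nat.mod_eq_of_lt hn0]
    · rw [hx₀, hx₁, axisSite_val, axisSite_val, if_neg hj, if_neg hj]
  · -- the reverse orientation is not a torus bond (L ≥ 2)
    intro h01
    obtain ⟨i, hi, -⟩ := (mem_torusBonds x₀ x₁).1 h01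
    rw [hx₀, hx₁, axisSite_val, axisSite_val] at hi
    exfalso
    by_cases hii : i = i₀
    · rw [if_pos hii, if_pos hii, Nat.mod_eq_of_lt (by omega)] at hi
      omega
    · rw [if_neg hii, if_neg hii, Nat.mod_eq_of_lt hn3] at hi
      omega
  · -- x₀ is the only site of the cube c bonded to x₁
    intro x hx hb
    obtain ⟨hge, hlt⟩ := memc x hx
    rcases hb with hb | hb
    · obtain ⟨i, hi, hrest⟩ := (mem_torusBonds x x₁).1 hb
      exfalso
      by_cases hii : i = i₀
      · subst hii
        rw [hx₁, axisSite_val, if_pos rfl] at hi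
        by_cases hN : (x i₀).val + 1 < nSide K l
        · rw [Nat.mod_eq_of_lt hN] at hi
          omega
        · have hN' : (x i₀).val + 1 = nSide K l := by omega
          rw [hN', Nat.mod_self] at hi
          omega
      · have h1 := congrArg Fin.val (hrest i₀ (Ne.symm hii))
        rw [hx₁, axisSite_val, if_pos rfl] at h1
        omega
    · obtain ⟨i, hi, hrest⟩ := (mem_torusBonds x₁ x).1 hb
      by_cases hii : i = i₀
      · subst hii
        rw [hx₁, axisSite_val, if_pos rfl, Nat.mod_eq_of_lt hn0] at hi
        funext j
        apply Fin.ext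
        rw [hx₀, axisSite_val]
        by_cases hj : j = i₀
        · subst hj
          rw [if_pos rfl]
          exact hi
        · rw [if_neg hj, hrest j hj, hx₁, axisSite_val, if_neg hj]
      · exfalso
        have h1 := congrArg Fin.val (hrest i₀ (Ne.symm hii))
        rw [hx₁, axisSite_val, if_pos rfl] at h1
        omega

/-- **The torus, K ≥ 2, K ≥ 3 or L ≥ 3, d ≥ 1, EVERY background: (1.91)'s H′ ≠ [4]'s H′ (3.163)** for every (3.25)-data
with a = diag(a_c), a_c ≠ 0. [cite: Balaban1985RegularSpaces, (1.91) p. 91, p. 77 (T_η);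
Balaban1985BackgroundPropagators, (3.24)–(3.25) p. 394, (3.163)–(3.165) p. 429] -/
theorem Hp_ne_H4_torus_background (hd : 0 < d) (hl : 1 ≤ l) (hK : 2 ≤ K) (h3 : 3 ≤ K ∨ 2 ≤ l) [Nontrivial V]
    (τ : (Fin d → Fin (nSide K l)) → (Fin d → Fin (nSide K l)) → V →ₗ[ℝ] V)
    (hinj : ∀ x x', Function.Injective (τ x x'))
    {cb : (Fin d → Fin (nSide K l)) × (Fin d → Fin (nSide K l)) → ℝ}
    (hcb : ∀ b ∈ torusBonds (Fin d) (nSide K l), 0 < cb b)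
    {w : (Fin d → Fin K) → (Fin d → Fin (nSide K l)) → ℝ}
    (hw : ∀ c, ∀ x ∈ blocksOf (boxBlk (l + 1) K rfl) c, w c x ≠ 0)
    (Γ : (Fin d → Fin K) → (Fin d → Fin (nSide K l)) → List (Fin d → Fin (nSide K l)))
    (y : (Fin d → Fin K) → Fin d → Fin (nSide K l)) (a : (Fin d → Fin K) → ℝ) (ha : ∀ c, a c ≠ 0)
    {g : PiLp 2 (fun _ : Fin d → Fin (nSide K l) => V) →ₗ[ℝ] PiLp 2 (fun _ : Fin d → Fin (nSide K l) => V)}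
    {cc : PiLp 2 (fun _ : Fin d → Fin K => V) →ₗ[ℝ] PiLp 2 (fun _ : Fin d → Fin K => V)}
    (hdata : Data (lapL τ (torusBonds (Fin d) (nSide K l)) cb) (qL τ w (blocksOf (boxBlk (l + 1) K rfl)) Γ y)
      (LinearMap.adjoint (qL τ w (blocksOf (boxBlk (l + 1) K rfl)) Γ y)) (AL a) g cc) :
    ∃ μ, Hp (LinearMap.adjoint (qL τ w (blocksOf (boxBlk (l + 1) K rfl)) Γ y)) g cc μ
      ≠ H4 (qL τ w (blocksOf (boxBlk (l + 1) K rfl)) Γ y)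
          (LinearMap.adjoint (qL τ w (blocksOf (boxBlk (l + 1) K rfl)) Γ y)) (AL a) g cc μ := by
  by_contra hall
  refine not_criterion_torus d K l hd hl hK h3 τ hinj hcb hw Γ y
    (criterion_of_H4_eq_Hp hdata (AL_surjectiveV' a ha) fun μ => ?_)
  by_contra hμ
  exact hall ⟨μ, fun e => hμ e.symm⟩

/-- **Hypothesis-free, torus: on the printed cubes the (3.25)-data exist at every background and (1.91)'s H′ ≠ [4]'s H′**
(K ≥ 2, K ≥ 3 or L ≥ 3, d ≥ 1; uniform κ ≠ 0, unit bond weights, a_c > 0). [cite: Balaban1985RegularSpaces, (1.91) p. 91,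
p. 77 (T_η); Balaban1985BackgroundPropagators, (3.18)–(3.19) p. 393, (3.24)–(3.25) p. 394, Thm 3.11 p. 416,
(3.163)–(3.165) p. 429] -/
theorem exists_data_Hp_ne_H4_torus_background (hd : 0 < d) (hl : 1 ≤ l) (hK : 2 ≤ K) (h3 : 3 ≤ K ∨ 2 ≤ l)
    [Nontrivial V] (τ : (Fin d → Fin (nSide K l)) → (Fin d → Fin (nSide K l)) → V →ₗ[ℝ] V)
    (hinj : ∀ x x', Function.Injective (τ x x')) {κ : ℝ} (hκ : κ ≠ 0) (a : (Fin d → Fin K) → ℝ)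
    (ha : ∀ c, 0 < a c) :
    ∃ (g : PiLp 2 (fun _ : Fin d → Fin (nSide K l) => V) →ₗ[ℝ] PiLp 2 (fun _ : Fin d → Fin (nSide K l) => V))
      (cc : PiLp 2 (fun _ : Fin d → Fin K => V) →ₗ[ℝ] PiLp 2 (fun _ : Fin d → Fin K => V)),
      Data (lapL τ (torusBonds (Fin d) (nSide K l)) (fun _ => 1))
          (qL τ (fun _ _ => κ) (blocksOf (boxBlk (l + 1) K rfl)) (ΓBox d K l) (yBox d K l))
          (LinearMap.adjoint (qL τ (fun _ _ => κ) (blocksOf (boxBlk (l + 1) K rfl)) (ΓBox d K l) (yBox d K l)))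
          (AL a) g cc ∧
        ∃ μ, Hp (LinearMap.adjoint (qL τ (fun _ _ => κ) (blocksOf (boxBlk (l + 1) K rfl)) (ΓBox d K l) (yBox d K l)))
            g cc μ
          ≠ H4 (qL τ (fun _ _ => κ) (blocksOf (boxBlk (l + 1) K rfl)) (ΓBox d K l) (yBox d K l))
              (LinearMap.adjoint (qL τ (fun _ _ => κ) (blocksOf (boxBlk (l + 1) K rfl)) (ΓBox d K l) (yBox d K l)))
              (AL a) g cc μ := by
  have hcb : ∀ b ∈ torusBonds (Fin d) (nSide K l), (0 : ℝ) < (fun _ => (1 : ℝ)) b := fun _ _ => one_pos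
  have hS := isBlockSystem_torus d K l hκ
  exact ⟨gL τ (fun _ => 1) a hinj hcb hS ha, cL τ (fun _ => 1) a hinj hcb hS ha, data_L hinj hcb hS ha,
    Hp_ne_H4_torus_background d K l hd hl hK h3 τ hinj hcb (fun _ _ _ => hκ) _ _ a (fun c => (ha c).ne')
      (data_L hinj hcb hS ha)⟩

end Torus

/-! ## §5  One block (K = 1) is background-dependent: a single defect bond off the contours breaks the criterion -/

section OneBlock

variable {X : Type*} {Y : Type*} {V : Type*} [NormedAddCommGroup V] [InnerProductSpace ℝ V]
variable [DecidableEq X]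

/-- Transports equal to the identity on every bond except one, ⟨p, q⟩, where they are R: a background whose only
non-trivial bond variable sits on ⟨p, q⟩ (curvature concentrated on the plaquettes through it).
[cite: Balaban1985BackgroundPropagators, (3.3) p. 391, (3.19) p. 393] -/
def defectT (p q : X) (R : V →ₗ[ℝ] V) : X → X → V →ₗ[ℝ] V :=
  fun x x' => if x = p ∧ x' = q then R else LinearMap.id

/-- `defectT` on the defect bond. [cite: Balaban1985BackgroundPropagators, (3.3) p. 391] -/
theorem defectT_same (p q : X) (R : V →ₗ[ℝ] V) : defectT p q R p q = R := if_pos ⟨rfl, rfl⟩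

/-- `defectT` off the defect bond. [cite: Balaban1985BackgroundPropagators, (3.3) p. 391] -/
theorem defectT_of_ne {p q x x' : X} (R : V →ₗ[ℝ] V) (h : ¬ (x = p ∧ x' = q)) : defectT p q R x x' = LinearMap.id :=
  if_neg h

/-- The defect background has injective transports when R is injective. [cite: Balaban1985BackgroundPropagators, (3.3) p. 391] -/
theorem defectT_injective (p q : X) {R : V →ₗ[ℝ] V} (hR : Function.Injective R) (x x' : X) :
    Function.Injective (defectT p q R x x') := by
  unfold defectT
  split_ifs
  · exact hR
  · exact fun a b h => h

/-- Transport along a contour avoiding the defect bond is the identity. [cite: Balaban1985BackgroundPropagators, (3.19) p. 393] -/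
theorem pathTr_defectT_of_avoid (p q : X) (R : V →ₗ[ℝ] V) :
    ∀ L : List X, List.IsChain (fun a b => ¬ (a = p ∧ b = q)) L → pathTr (defectT p q R) L = LinearMap.id
  | [], _ => rfl
  | [_], _ => rfl
  | x :: x' :: rest, h => by
    rw [List.isChain_cons_cons] at h
    rw [pathTr_cons_cons, pathTr_defectT_of_avoid p q R (x' :: rest) h.2, defectT_of_ne R h.1]
    rfl

variable [Fintype X] [FiniteDimensional ℝ V]

/-- **K = 1 is background-dependent.**  One block B(c) = all sites with uniform weight κ ≠ 0 and contours avoiding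
the bond ⟨p, q⟩; transports = 1 except R(U(⟨p, q⟩)) = R with R invertible, R ≠ 1; a third site r.  Then λ :=
δ_q u − δ_r u ∈ N(Q′) has ⟨(Q′Δλ)(c), v⟩ = κ c_{⟨p,q⟩}⟨Ru, Rv − v⟩, which is ≠ 0 for suitable u, v: the criterion
Q′ΔN(Q′) = 0 FAILS — whereas at the flat background (R = 1) on one block it holds (part 6, K = 1).
[cite: Balaban1985BackgroundPropagators, (3.19) p. 393, (3.23) p. 394, (3.162)–(3.165) p. 429;
Balaban1985RegularSpaces, (1.91) p. 91] -/
theorem not_criterion_oneBlock_defect {bonds : Finset (X × X)} (cb : X × X → ℝ) (hcb : ∀ b ∈ bonds, 0 ≤ cb b)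
    {w : Y → X → ℝ} {B : Y → Finset X} (Γ : Y → X → List X) (y : Y → X) {c : Y} {κ : ℝ} (hκ : κ ≠ 0)
    (hone : ∀ c'' x, x ∈ B c'' → c'' = c) (hcov : ∀ x, x ∈ B c) (hw : ∀ x, w c x = κ) {p q r : X}
    (hpq : (p, q) ∈ bonds) (hcpq : 0 < cb (p, q)) (hqp : q ≠ p) (hrp : r ≠ p) (hrq : r ≠ q)
    (havoid : ∀ x ∈ B c, List.IsChain (fun a b => ¬ (a = p ∧ b = q)) (y c :: Γ c x))
    {R : V →ₗ[ℝ] V} (hR : Function.Injective R) (hR1 : R ≠ LinearMap.id) :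
    ¬ ∀ f : PiLp 2 (fun _ : X => V), qL (defectT p q R) w B Γ y f = 0 →
        qL (defectT p q R) w B Γ y (lapL (defectT p q R) bonds cb f) = 0 := by
  intro hcrit
  -- u, v with ⟨Ru, Rv − v⟩ ≠ 0: v with Rv ≠ v, u := R⁻¹(Rv − v)
  obtain ⟨v, hv⟩ : ∃ v, R v - v ≠ 0 := by
    by_contra hall
    exact hR1 (LinearMap.ext fun v => sub_eq_zero.mp (not_not.mp (not_exists.mp hall v)))
  obtain ⟨u, hu⟩ := (LinearMap.injective_iff_surjective.mp hR) (R v - v)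
  set f : PiLp 2 (fun _ : X => V) := single q u - single r u with hf
  have hfx : ∀ x, f x = (if x = q then u else 0) - (if x = r then u else 0) := fun x => by
    rw [hf, PiLp.sub_apply, single_apply, single_apply]
  have hfq : f q = u := by rw [hfx, if_pos rfl, if_neg hrq.symm, sub_zero]
  have hfp : f p = 0 := by rw [hfx, if_neg hqp.symm, if_neg hrp.symm, sub_zero]
  have hP : ∀ x ∈ B c, pathTr (defectT p q R) (y c :: Γ c x) = LinearMap.id :=
    fun x hx => pathTr_defectT_of_avoid p q R _ (havoid x hx)
  -- λ ∈ N(Q′)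
  have hq : qL (defectT p q R) w B Γ y f = 0 := by
    ext c''
    rw [hf, map_sub, PiLp.sub_apply, qL_single, qL_single, PiLp.zero_apply]
    by_cases hc'' : c'' = c
    · subst hc''
      rw [if_pos (hcov q), if_pos (hcov r), hP q (hcov q), hP r (hcov r), hw, hw, sub_self]
    · rw [if_neg (fun h => hc'' (hone _ _ h)), if_neg (fun h => hc'' (hone _ _ h)), sub_zero]
  -- ⟨Σ_x (Δλ)(x), v'⟩ = Σ_b c_b ⟨(Dλ)(b), R(U(b))v' − v'⟩ = c_{pq}⟨Ru, Rv' − v'⟩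
  have hsum : ∀ v' : V, ⟪∑ x, lapL (defectT p q R) bonds cb f x, v'⟫_ℝ = cb (p, q) * ⟪R u, R v' - v'⟫_ℝ := by
    intro v'
    rw [sum_inner, Finset.sum_congr rfl fun x _ => inner_lapL_apply (defectT p q R) bonds cb hcb f x v',
      Finset.sum_comm]
    have e : ∀ b ∈ bonds, ∑ x, cb b * ⟪covD (defectT p q R) (WithLp.ofLp f) b.1 b.2,
        covD (defectT p q R) (Pi.single x v') b.1 b.2⟫_ℝ
        = cb b * ⟪covD (defectT p q R) (WithLp.ofLp f) b.1 b.2, defectT p q R b.1 b.2 v' - v'⟫_ℝ := by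
      intro b _
      rw [← Finset.mul_sum, ← inner_sum]
      congr 2
      simp only [covD_apply]
      rw [Finset.sum_sub_distrib, ← map_sum, Finset.sum_pi_single, Finset.sum_pi_single, if_pos (mem_univ _),
        if_pos (mem_univ _)]
    rw [Finset.sum_congr rfl e, Finset.sum_eq_single_of_mem (p, q) hpq fun b hb hne => ?_]
    · rw [defectT_same, covD_apply, defectT_same]
      show cb (p, q) * ⟪R (f q) - f p, R v' - v'⟫_ℝ = _
      rw [hfq, hfp, sub_zero]
    · obtain ⟨b₁, b₂⟩ := b
      have hne' : ¬ (b₁ = p ∧ b₂ = q) := fun h => hne (by rw [h.1, h.2])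
      dsimp only
      rw [defectT_of_ne R hne', LinearMap.id_apply, sub_self, inner_zero_right, mul_zero]
  -- the criterion gives Q′Δλ = 0, whose c-component is κ Σ_x (Δλ)(x)
  have h1 := congrArg (fun φ : PiLp 2 (fun _ : Y => V) => φ c) (hcrit f hq)
  simp only [PiLp.zero_apply] at h1
  rw [qL_apply] at h1
  unfold avgQ at h1
  rw [Finset.sum_congr rfl fun x hx => by rw [hP x hx, hw, LinearMap.id_apply], ← Finset.smul_sum,
    smul_eq_zero] at h1
  rcases h1 with h1 | h1
  · exact hκ h1
  · have hBc : B c = univ := Finset.eq_univ_iff_forall.2 hcov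
    rw [hBc] at h1
    have h2 := hsum v
    rw [show (∑ x, WithLp.ofLp (lapL (defectT p q R) bonds cb f) x) = ∑ x, lapL (defectT p q R) bonds cb f x
      from rfl] at h1
    rw [h1, inner_zero_left, hu, eq_comm, mul_eq_zero] at h2
    rcases h2 with h2 | h2
    · exact hcpq.ne' h2
    · exact hv (inner_self_eq_zero.mp h2)

end OneBlock

end Literature.MathematicalPhysics.QuantumFieldTheory.Balaban1983to89.B8Eq194CriterionCurved
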